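import Mathlib
import Literature.NumberTheory.Transcendental.SemialgebraicMapsProofs
import Literature.NumberTheory.Transcendental.SemialgebraicVolume
import Literature.ModelTheory.ExponentialFields.SemialgebraicInterior

/-!
# Crux `SymplecticScissors.PlanarSAZylev` (stmt-KontsevichZagierPeriods-9848),
line `reservoir-peeling`, stub `stub_teCalc`: calculus of the pseudogroup equivalence

The pinned relation `E A B` says: an open co-null `ℚ`-semialgebraic part `U` of `A` is carried by
one `ℚ`-semialgebraic `C¹` injection `Φ` with `|det DΦ| = 1` onto a co-null part of `B`.  We prove
three facts about `E`.

* **(M) measure preservation** (`teCalc_volume_image`): such a `Φ` preserves the Lebesgue measure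
  of every measurable `S ⊆ U` — the change of variables formula
  `∫⁻ x in S, |det DΦ x| = volume (Φ '' S)`
  (`MeasureTheory.lintegral_abs_det_fderiv_eq_addHaar_image`) with integrand `1`.
* **(V) area** (`teCalc_volume_eq`): `E A B → volume A = volume B`, since `A`, `U`, `Φ '' U`, `B`
  all have the same measure.
* **(T) transitivity** (`teCalc_trans`): witnesses `(U₁, Φ₁)` of `E A B` and `(U₂, Φ₂)` of `E B C`
  compose to the witness `(U₁ ∩ Φ₁⁻¹ U₂, Φ₂ ∘ Φ₁)` of `E A C`; the source is `ℚ`-semialgebraic by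
  the preimage lemma `teCalc_isSemialgebraic_preimage` (Tarski–Seidenberg projection of
  `graph Φ₁ ∩ (ℝ² × U₂)`), the discarded part `U₁ \ Φ₁⁻¹ U₂` is null because `Φ₁` carries it,
  measure preservingly, into the null set `B \ U₂`, and the missed part of `C` is contained in
  `(C \ Φ₂ '' U₂) ∪ Φ₂ '' (U₂ \ Φ₁ '' U₁)`, the image of a null set under a `C¹` map being null
  (`MeasureTheory.addHaar_image_eq_zero_of_differentiableOn_of_addHaar_eq_zero`).  The Jacobian
  of the composite is the product of the Jacobians (chain rule, multiplicativity of `det`).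
* **(R) 2 × 2 Riesz refinement** (`teCalc_refine`): an instance `A₀ ⊔ A₁ ~ B₀ ⊔ B₁` with witness
  `(U, Φ)` refines into the four instances `Cᵢⱼ ~ Dᵢⱼ`, `Cᵢⱼ := Aᵢ ∩ U ∩ Φ⁻¹ Bⱼ`, `Dᵢⱼ := Φ '' Cᵢⱼ`,
  each witnessed by the restriction of `Φ` to the interior of `Cᵢⱼ` (`teCalc_restrict`; the
  frontier of a semialgebraic set is null, `volume_frontier_eq_zero_of_isSemialgebraic`).

Sources: the change of variables formula and Sard-type null-image lemma (Mathlib,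
`Mathlib/MeasureTheory/Function/Jacobian.lean`); Bochnak–Coste–Roy 1998, §2.2 (semialgebraic maps,
Tarski–Seidenberg).  Everything here is folklore bookkeeping; no new definitions.
-/

noncomputable section

open MeasureTheory Set
open Literature.NumberTheory.Transcendental Literature.ModelTheory.ExponentialFields

namespace Summit.KontsevichZagierPeriods.SymplecticScissors.PlanarSAZylev

/-- **Preimage lemma.** If `Φ` is a `ℚ`-semialgebraic map on `U ⊆ ℝ ^ m` and `T ⊆ ℝ ^ n` is
`ℚ`-semialgebraic, then `{x ∈ U | Φ x ∈ T}` is `ℚ`-semialgebraic: it is the projection onto the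
first `m` coordinates of `graph Φ|ᵤ ∩ (ℝ ^ m × T)` (Tarski–Seidenberg,
`IsSemialgebraic.image_castAdd`; Bochnak–Coste–Roy 1998, Prop. 2.2.7). [folklore] -/
theorem teCalc_isSemialgebraic_preimage {m n : ℕ} {U : Set (Fin m → ℝ)}
    {Φ : (Fin m → ℝ) → (Fin n → ℝ)} {T : Set (Fin n → ℝ)} (hΦsa : IsSemialgebraicMapOn ℚ U Φ)
    (hT : IsSemialgebraic ℚ T) : IsSemialgebraic ℚ {x | x ∈ U ∧ Φ x ∈ T} := by
  have hW : IsSemialgebraic ℚ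
      ({z : Fin (m + n) → ℝ | ∃ x ∈ U, z = Fin.append x (Φ x)} ∩
        (fun z : Fin (m + n) → ℝ => z ∘ Fin.natAdd m) ⁻¹' T) :=
    IsSemialgebraic.inter hΦsa (hT.preimage_comp (Fin.natAdd m))
  convert hW.image_castAdd using 1
  ext x
  simp only [mem_setOf_eq, mem_image, mem_inter_iff, mem_preimage]
  constructor
  · rintro ⟨hxU, hxT⟩
    refine ⟨Fin.append x (Φ x), ⟨⟨x, hxU, rfl⟩, ?_⟩, ?_⟩
    · convert hxT using 1
      funext j
      simp
    · funext i
      simp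
  · rintro ⟨z, ⟨⟨x', hx', rfl⟩, hzT⟩, rfl⟩
    have h1 : (fun i => Fin.append x' (Φ x') (Fin.castAdd n i)) = x' := by
      funext i
      simp
    rw [h1]
    refine ⟨hx', ?_⟩
    convert hzT using 1
    funext j
    simp

/-- **(M) Measure preservation.** If `Φ` is `C¹` and injective on the open set `U` with
`|det (fderiv ℝ Φ p)| = 1` on `U`, then `volume (Φ '' S) = volume S` for every measurable `S ⊆ U`:
the change of variables formula `∫⁻ x in S, |det DΦ x| = volume (Φ '' S)` with integrand `1`.
[folklore] -/
theorem teCalc_volume_image {U S : Set (Fin 2 → ℝ)} {Φ : (Fin 2 → ℝ) → (Fin 2 → ℝ)}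
    (hUo : IsOpen U) (hΦC1 : ContDiffOn ℝ 1 Φ U) (hinj : InjOn Φ U)
    (hdet : ∀ p ∈ U, |(fderiv ℝ Φ p).det| = 1) (hSU : S ⊆ U) (hS : MeasurableSet S) :
    volume (Φ '' S) = volume S := by
  have hd : ∀ x ∈ S, HasFDerivWithinAt Φ (fderiv ℝ Φ x) S x := fun x hx =>
    (((hΦC1.differentiableOn one_ne_zero).differentiableAt
      (hUo.mem_nhds (hSU hx))).hasFDerivAt).hasFDerivWithinAt
  have h1 : EqOn (fun x => ENNReal.ofReal |(fderiv ℝ Φ x).det|) (fun _ => 1) S := fun x hx => by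
    simp only [hdet x (hSU hx), ENNReal.ofReal_one]
  rw [← lintegral_abs_det_fderiv_eq_addHaar_image volume hS hd (hinj.mono hSU),
    setLIntegral_congr_fun hS h1, setLIntegral_one]

/-- **(V) Area is an invariant.** A witness `(U, Φ)` of `E A B` forces `volume A = volume B`:
`volume A = volume U` (`A \ U` is null), `volume U = volume (Φ '' U)` by measure preservation,
and `volume (Φ '' U) = volume B` (`B \ Φ '' U` is null). [folklore] -/
theorem teCalc_volume_eq {A B U : Set (Fin 2 → ℝ)} {Φ : (Fin 2 → ℝ) → (Fin 2 → ℝ)}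
    (hUA : U ⊆ A) (hUo : IsOpen U) (hAU : volume (A \ U) = 0)
    (hΦC1 : ContDiffOn ℝ 1 Φ U) (hinj : InjOn Φ U)
    (hdet : ∀ p ∈ U, |(fderiv ℝ Φ p).det| = 1) (hΦB : Φ '' U ⊆ B)
    (hBΦ : volume (B \ Φ '' U) = 0) : volume A = volume B := by
  rw [← measure_eq_measure_of_null_sdiff hUA hAU, ← measure_eq_measure_of_null_sdiff hΦB hBΦ,
    teCalc_volume_image hUo hΦC1 hinj hdet subset_rfl hUo.measurableSet]

/-- **(T) Composition of witnesses.** From a witness `(U₁, Φ₁)` of `E A B` and a witness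
`(U₂, Φ₂)` of `E B C` we get the witness `(U₁ ∩ Φ₁⁻¹ U₂, Φ₂ ∘ Φ₁)` of `E A C`.  The source is open
(continuity of `Φ₁`) and `ℚ`-semialgebraic (`teCalc_isSemialgebraic_preimage`); `A \ U` is null
because `U₁ \ Φ₁⁻¹ U₂` is carried measure-preservingly by `Φ₁` into the null set `B \ U₂`;
`C \ (Φ₂ ∘ Φ₁) '' U ⊆ (C \ Φ₂ '' U₂) ∪ Φ₂ '' (U₂ \ Φ₁ '' U₁)` is null because `C¹` maps send null
sets to null sets; the Jacobian of the composite is the product of the Jacobians. [folklore] -/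
theorem teCalc_trans {A B C U₁ U₂ : Set (Fin 2 → ℝ)} {Φ₁ Φ₂ : (Fin 2 → ℝ) → (Fin 2 → ℝ)}
    (hUA : U₁ ⊆ A) (hU₁o : IsOpen U₁) (hAU : volume (A \ U₁) = 0)
    (hΦ₁sa : IsSemialgebraicMapOn ℚ U₁ Φ₁) (hΦ₁C1 : ContDiffOn ℝ 1 Φ₁ U₁) (hinj₁ : InjOn Φ₁ U₁)
    (hdet₁ : ∀ p ∈ U₁, |(fderiv ℝ Φ₁ p).det| = 1) (hΦB : Φ₁ '' U₁ ⊆ B)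
    (hBΦ : volume (B \ Φ₁ '' U₁) = 0)
    (hUB : U₂ ⊆ B) (hU₂sa : IsSemialgebraic ℚ U₂) (hU₂o : IsOpen U₂) (hBU : volume (B \ U₂) = 0)
    (hΦ₂sa : IsSemialgebraicMapOn ℚ U₂ Φ₂) (hΦ₂C1 : ContDiffOn ℝ 1 Φ₂ U₂) (hinj₂ : InjOn Φ₂ U₂)
    (hdet₂ : ∀ p ∈ U₂, |(fderiv ℝ Φ₂ p).det| = 1) (hΦC : Φ₂ '' U₂ ⊆ C)
    (hCΦ : volume (C \ Φ₂ '' U₂) = 0) :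
    ∃ (U : Set (Fin 2 → ℝ)) (Φ : (Fin 2 → ℝ) → (Fin 2 → ℝ)),
      U ⊆ A ∧ IsSemialgebraic ℚ U ∧ IsOpen U ∧ volume (A \ U) = 0 ∧
      IsSemialgebraicMapOn ℚ U Φ ∧ ContDiffOn ℝ 1 Φ U ∧ InjOn Φ U ∧
      (∀ p ∈ U, |(fderiv ℝ Φ p).det| = 1) ∧ Φ '' U ⊆ C ∧ volume (C \ Φ '' U) = 0 := by
  set U : Set (Fin 2 → ℝ) := {x | x ∈ U₁ ∧ Φ₁ x ∈ U₂}
  have hUU₁ : U ⊆ U₁ := fun x hx => hx.1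
  have hmaps : MapsTo Φ₁ U U₂ := fun x hx => hx.2
  have hUo : IsOpen U := hΦ₁C1.continuousOn.isOpen_inter_preimage hU₁o hU₂o
  have hUsa : IsSemialgebraic ℚ U := teCalc_isSemialgebraic_preimage hΦ₁sa hU₂sa
  refine ⟨U, Φ₂ ∘ Φ₁, hUU₁.trans hUA, hUsa, hUo, ?_,
    IsSemialgebraicMapOn.comp_holds hΦ₂sa (hΦ₁sa.mono hUU₁ hUsa) hmaps,
    hΦ₂C1.comp (hΦ₁C1.mono hUU₁) hmaps, hinj₂.comp (hinj₁.mono hUU₁) hmaps, ?_, ?_, ?_⟩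
  · -- `A \ U ⊆ (A \ U₁) ∪ (U₁ \ U)` and
    -- `volume (U₁ \ U) = volume (Φ₁ '' (U₁ \ U)) ≤ volume (B \ U₂) = 0`
    have hS : volume (Φ₁ '' (U₁ \ U)) = 0 := by
      refine measure_mono_null ?_ hBU
      rintro _ ⟨x, hx, rfl⟩
      exact ⟨hΦB ⟨x, hx.1, rfl⟩, fun h2 => hx.2 ⟨hx.1, h2⟩⟩
    rw [teCalc_volume_image hU₁o hΦ₁C1 hinj₁ hdet₁ sdiff_subset
      (hU₁o.measurableSet.diff hUo.measurableSet)] at hS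
    refine measure_mono_null (fun x hx => ?_) (measure_union_null hAU hS)
    by_cases hx1 : x ∈ U₁
    · exact Or.inr ⟨hx1, hx.2⟩
    · exact Or.inl ⟨hx.1, hx1⟩
  · -- chain rule and multiplicativity of the determinant
    intro p hp
    have hd₁ : DifferentiableAt ℝ Φ₁ p :=
      (hΦ₁C1.differentiableOn one_ne_zero).differentiableAt (hU₁o.mem_nhds hp.1)
    have hd₂ : DifferentiableAt ℝ Φ₂ (Φ₁ p) :=
      (hΦ₂C1.differentiableOn one_ne_zero).differentiableAt (hU₂o.mem_nhds hp.2)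
    rw [fderiv_comp p hd₂ hd₁, ContinuousLinearMap.det, ContinuousLinearMap.toLinearMap_comp,
      LinearMap.det_comp, abs_mul]
    change |(fderiv ℝ Φ₂ (Φ₁ p)).det| * |(fderiv ℝ Φ₁ p).det| = 1
    rw [hdet₂ _ hp.2, hdet₁ _ hp.1, mul_one]
  · rintro _ ⟨x, hx, rfl⟩
    exact hΦC ⟨Φ₁ x, hx.2, rfl⟩
  · -- `C \ Φ '' U ⊆ (C \ Φ₂ '' U₂) ∪ Φ₂ '' (U₂ \ Φ₁ '' U₁)`, and
    -- `U₂ \ Φ₁ '' U₁ ⊆ B \ Φ₁ '' U₁` is null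
    have hS₀ : volume (U₂ \ Φ₁ '' U₁) = 0 := by
      refine measure_mono_null (fun y hy => ?_) hBΦ
      exact ⟨hUB hy.1, hy.2⟩
    have hS : volume (Φ₂ '' (U₂ \ Φ₁ '' U₁)) = 0 :=
      addHaar_image_eq_zero_of_differentiableOn_of_addHaar_eq_zero volume
        ((hΦ₂C1.differentiableOn one_ne_zero).mono sdiff_subset) hS₀
    refine measure_mono_null (fun y hy => ?_) (measure_union_null hCΦ hS)
    by_cases hy2 : y ∈ Φ₂ '' U₂
    · obtain ⟨z, hz, rfl⟩ := hy2
      refine Or.inr ⟨z, ⟨hz, ?_⟩, rfl⟩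
      rintro ⟨x, hx, rfl⟩
      exact hy.2 ⟨x, ⟨hx, hz⟩, rfl⟩
    · exact Or.inl ⟨hy.1, hy2⟩

/-- **Restriction of a witness to a semialgebraic subset.** If `(U, Φ)` carries witness data
(`U` open, `Φ` a `ℚ`-semialgebraic `C¹` injection on `U` with `|det DΦ| = 1`) and `S ⊆ U` is
`ℚ`-semialgebraic, then `(interior S, Φ)` is a witness of `E S (Φ '' S)`: `S \ interior S` lies in
the null frontier of `S` (`volume_frontier_eq_zero_of_isSemialgebraic`), and
`Φ '' S \ Φ '' interior S ⊆ Φ '' (S \ interior S)` is the image of a null set under a `C¹` map.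
[folklore] -/
theorem teCalc_restrict {U S : Set (Fin 2 → ℝ)} {Φ : (Fin 2 → ℝ) → (Fin 2 → ℝ)}
    (hΦsa : IsSemialgebraicMapOn ℚ U Φ) (hΦC1 : ContDiffOn ℝ 1 Φ U)
    (hinj : InjOn Φ U) (hdet : ∀ p ∈ U, |(fderiv ℝ Φ p).det| = 1) (hSU : S ⊆ U)
    (hS : IsSemialgebraic ℚ S) :
    ∃ (V : Set (Fin 2 → ℝ)) (Ψ : (Fin 2 → ℝ) → (Fin 2 → ℝ)),
      V ⊆ S ∧ IsSemialgebraic ℚ V ∧ IsOpen V ∧ volume (S \ V) = 0 ∧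
      IsSemialgebraicMapOn ℚ V Ψ ∧ ContDiffOn ℝ 1 Ψ V ∧ InjOn Ψ V ∧
      (∀ p ∈ V, |(fderiv ℝ Ψ p).det| = 1) ∧ Ψ '' V ⊆ Φ '' S ∧ volume (Φ '' S \ Ψ '' V) = 0 := by
  have hIU : interior S ⊆ U := interior_subset.trans hSU
  have hnull : volume (S \ interior S) = 0 := by
    refine measure_mono_null (fun x hx => ?_) (volume_frontier_eq_zero_of_isSemialgebraic hS)
    exact ⟨subset_closure hx.1, hx.2⟩
  refine ⟨interior S, Φ, interior_subset, isSemialgebraic_interior hS, isOpen_interior, hnull,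
    hΦsa.mono hIU (isSemialgebraic_interior hS), hΦC1.mono hIU, hinj.mono hIU,
    fun p hp => hdet p (hIU hp), image_mono interior_subset, ?_⟩
  refine measure_mono_null ?_ (addHaar_image_eq_zero_of_differentiableOn_of_addHaar_eq_zero
    volume ((hΦC1.differentiableOn one_ne_zero).mono (sdiff_subset.trans hSU)) hnull)
  rintro _ ⟨⟨x, hx, rfl⟩, hy⟩
  exact ⟨x, ⟨hx, fun hxi => hy ⟨x, hxi, rfl⟩⟩, rfl⟩

/-- **(R) The 2 × 2 Riesz refinement.** An instance `E (A 0 ∪ A 1) (B 0 ∪ B 1)` with witness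
`(U, Φ)`, for `ℚ`-semialgebraic pairwise disjoint `Aᵢ` and `Bⱼ`, refines into the four instances
`E (C i j) (D i j)` with `C i j := A i ∩ {x ∈ U | Φ x ∈ B j}` and `D i j := Φ '' C i j`
(`teCalc_restrict`); the `C i ·` exhaust `A i` and the `D · j` exhaust `B j` up to the null sets
`(A 0 ∪ A 1) \ U` and `(B 0 ∪ B 1) \ Φ '' U`, and they are disjoint by disjointness of the `Bⱼ`,
resp. by injectivity of `Φ` and disjointness of the `Aᵢ`. [folklore] -/
theorem teCalc_refine (E : Set (Fin 2 → ℝ) → Set (Fin 2 → ℝ) → Prop)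
    (HE : ∀ A B : Set (Fin 2 → ℝ), E A B ↔
        ∃ (U : Set (Fin 2 → ℝ)) (Φ : (Fin 2 → ℝ) → (Fin 2 → ℝ)),
          U ⊆ A ∧ IsSemialgebraic ℚ U ∧ IsOpen U ∧ volume (A \ U) = 0 ∧
          IsSemialgebraicMapOn ℚ U Φ ∧ ContDiffOn ℝ 1 Φ U ∧ InjOn Φ U ∧
          (∀ p ∈ U, |(fderiv ℝ Φ p).det| = 1) ∧ Φ '' U ⊆ B ∧ volume (B \ Φ '' U) = 0)
    (A B : Fin 2 → Set (Fin 2 → ℝ)) (hA : ∀ i, IsSemialgebraic ℚ (A i))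
    (hB : ∀ j, IsSemialgebraic ℚ (B j)) (hAd : Disjoint (A 0) (A 1)) (hBd : Disjoint (B 0) (B 1))
    (h : E (A 0 ∪ A 1) (B 0 ∪ B 1)) :
    ∃ C D : Fin 2 → Fin 2 → Set (Fin 2 → ℝ),
      (∀ i j, IsSemialgebraic ℚ (C i j) ∧ IsSemialgebraic ℚ (D i j) ∧ C i j ⊆ A i ∧
        D i j ⊆ B j ∧ E (C i j) (D i j)) ∧
      (∀ i, Disjoint (C i 0) (C i 1) ∧ volume (A i \ (C i 0 ∪ C i 1)) = 0) ∧
      (∀ j, Disjoint (D 0 j) (D 1 j) ∧ volume (B j \ (D 0 j ∪ D 1 j)) = 0) := by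
  obtain ⟨U, Φ, hUA, -, -, hAU, hΦsa, hΦC1, hinj, hdet, hΦB, hBΦ⟩ := (HE _ _).1 h
  have hsubA : ∀ i : Fin 2, A i ⊆ A 0 ∪ A 1 :=
    Fin.forall_fin_two.2 ⟨subset_union_left, subset_union_right⟩
  have hsubB : ∀ j : Fin 2, B j ⊆ B 0 ∪ B 1 :=
    Fin.forall_fin_two.2 ⟨subset_union_left, subset_union_right⟩
  have hCU : ∀ i j, A i ∩ {x | x ∈ U ∧ Φ x ∈ B j} ⊆ U := fun i j x hx => hx.2.1
  have hCsa : ∀ i j, IsSemialgebraic ℚ (A i ∩ {x | x ∈ U ∧ Φ x ∈ B j}) := fun i j =>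
    (hA i).inter (teCalc_isSemialgebraic_preimage hΦsa (hB j))
  refine ⟨fun i j => A i ∩ {x | x ∈ U ∧ Φ x ∈ B j},
    fun i j => Φ '' (A i ∩ {x | x ∈ U ∧ Φ x ∈ B j}), fun i j => ?_, fun i => ?_, fun j => ?_⟩
  · refine ⟨hCsa i j, IsSemialgebraicMapOn.isSemialgebraic_image_holds hΦsa (hCU i j) (hCsa i j),
      inter_subset_left, ?_,
      (HE _ _).2 (teCalc_restrict hΦsa hΦC1 hinj hdet (hCU i j) (hCsa i j))⟩
    rintro _ ⟨x, hx, rfl⟩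
    exact hx.2.2
  · constructor
    · exact Set.disjoint_left.2 fun x hx0 hx1 => Set.disjoint_left.1 hBd hx0.2.2 hx1.2.2
    · refine measure_mono_null (fun x hx => ?_) hAU
      refine ⟨hsubA i hx.1, fun hxU => hx.2 ?_⟩
      rcases hΦB ⟨x, hxU, rfl⟩ with h0 | h1
      · exact Or.inl ⟨hx.1, hxU, h0⟩
      · exact Or.inr ⟨hx.1, hxU, h1⟩
  · constructor
    · refine Set.disjoint_left.2 ?_
      rintro _ ⟨x₀, hx₀, rfl⟩ ⟨x₁, hx₁, he⟩
      obtain rfl : x₁ = x₀ := hinj hx₁.2.1 hx₀.2.1 he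
      exact Set.disjoint_left.1 hAd hx₀.1 hx₁.1
    · refine measure_mono_null (fun y hy => ?_) hBΦ
      refine ⟨hsubB j hy.1, ?_⟩
      rintro ⟨x, hxU, rfl⟩
      rcases hUA hxU with h0 | h1
      · exact hy.2 (Or.inl ⟨x, ⟨h0, hxU, hy.1⟩, rfl⟩)
      · exact hy.2 (Or.inr ⟨x, ⟨h1, hxU, hy.1⟩, rfl⟩)

/-- **Calculus of the pseudogroup equivalence** (stub `stub_teCalc` of crux
`SymplecticScissors.PlanarSAZylev`, line `reservoir-peeling`): for the pinned relation `E`,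
transitivity (compose on `U₁ ∩ Φ₁⁻¹ U₂`, the discarded sets being null because `|det| = 1` maps
preserve area), preservation of area (Jacobian formula), and the 2 × 2 Riesz refinement of an
instance `A₀ ⊔ A₁ ~ B₀ ⊔ B₁` into four instances `Cᵢⱼ ~ Dᵢⱼ` (`Cᵢⱼ = Aᵢ ∩ U ∩ Φ⁻¹ Bⱼ`).
[folklore] -/
theorem stub_teCalc :
    ∀ (E : Set (Fin 2 → ℝ) → Set (Fin 2 → ℝ) → Prop),
      (∀ A B : Set (Fin 2 → ℝ), E A B ↔
        ∃ (U : Set (Fin 2 → ℝ)) (Φ : (Fin 2 → ℝ) → (Fin 2 → ℝ)),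
          U ⊆ A ∧ IsSemialgebraic ℚ U ∧ IsOpen U ∧ volume (A \ U) = 0 ∧
          IsSemialgebraicMapOn ℚ U Φ ∧ ContDiffOn ℝ 1 Φ U ∧ InjOn Φ U ∧
          (∀ p ∈ U, |(fderiv ℝ Φ p).det| = 1) ∧ Φ '' U ⊆ B ∧ volume (B \ Φ '' U) = 0) →
    (∀ A B C : Set (Fin 2 → ℝ), E A B → E B C → E A C) ∧
    (∀ A B : Set (Fin 2 → ℝ), E A B → volume A = volume B) ∧
    (∀ (A B : Fin 2 → Set (Fin 2 → ℝ)), (∀ i, IsSemialgebraic ℚ (A i)) →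
      (∀ j, IsSemialgebraic ℚ (B j)) → Disjoint (A 0) (A 1) → Disjoint (B 0) (B 1) →
      E (A 0 ∪ A 1) (B 0 ∪ B 1) →
      ∃ C D : Fin 2 → Fin 2 → Set (Fin 2 → ℝ),
        (∀ i j, IsSemialgebraic ℚ (C i j) ∧ IsSemialgebraic ℚ (D i j) ∧ C i j ⊆ A i ∧
          D i j ⊆ B j ∧ E (C i j) (D i j)) ∧
        (∀ i, Disjoint (C i 0) (C i 1) ∧ volume (A i \ (C i 0 ∪ C i 1)) = 0) ∧
        (∀ j, Disjoint (D 0 j) (D 1 j) ∧ volume (B j \ (D 0 j ∪ D 1 j)) = 0)) := by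
  intro E HE
  refine ⟨fun A B C hAB hBC => ?_, fun A B hAB => ?_, teCalc_refine E HE⟩
  · obtain ⟨U₁, Φ₁, hUA, -, hU₁o, hAU, hΦ₁sa, hΦ₁C1, hinj₁, hdet₁, hΦB, hBΦ⟩ := (HE A B).1 hAB
    obtain ⟨U₂, Φ₂, hUB, hU₂sa, hU₂o, hBU, hΦ₂sa, hΦ₂C1, hinj₂, hdet₂, hΦC, hCΦ⟩ := (HE B C).1 hBC
    exact (HE A C).2 (teCalc_trans hUA hU₁o hAU hΦ₁sa hΦ₁C1 hinj₁ hdet₁ hΦB hBΦ hUB hU₂sa hU₂o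
      hBU hΦ₂sa hΦ₂C1 hinj₂ hdet₂ hΦC hCΦ)
  · obtain ⟨U, Φ, hUA, -, hUo, hAU, -, hΦC1, hinj, hdet, hΦB, hBΦ⟩ := (HE A B).1 hAB
    exact teCalc_volume_eq hUA hUo hAU hΦC1 hinj hdet hΦB hBΦ

end Summit.KontsevichZagierPeriods.SymplecticScissors.PlanarSAZylev
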